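import Summits.Ventures.HodgeRepro2.T5SU11ResolventEigenfunction
import Summits.Ventures.HodgeRepro2.T5SU11KernelDifferenceRegularity
import Summits.Ventures.HodgeRepro2.T5SU11ResolventWeightedBasis

/-!
# The spherical transform diagonalises the resolvent on the whole exponentially decaying class

For `λ > 1`, `1 < λ′ < λ` and a source `g` of the exponentially decaying class at a rate `ε > λ′` (so that
`g φ_{λ′} sinh 2s` is integrable on `(0, ∞)`), the spherical transform `ĝ(λ′) = ∫_{(0,∞)} g φ_{λ′} sinh 2s ds` of the
resolvent is

**`(G^I_λ g)^(λ′) = ĝ(λ′)/(μ′ − μ)`** (`transform_greenSolI_eq`)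

— rows 467–470 had this for compactly supported sources; here it holds on the whole class. The proof is Fubini on
`K_λ(t, s) g(s) φ_{λ′}(t) sinh 2s sinh 2t` over `(0, ∞) × (0, ∞)` (`integrable_prod_kernel`: the kernel is
negative, so the absolute inner integral is computed by row 519's eigenfunction identity
`∫ K_λ(t, s) φ_{λ′}(t) sinh 2t dt = φ_{λ′}(s)/(μ′ − μ)`, and the outer integrand `|g| φ_{λ′} sinh 2s` is integrable
at the rate `ε > λ′`), followed by the same identity in the inner integral. Nothing is claimed about (N).

Blind lane: Mathlib + the HodgeRepro2 prefix only; no sorry; axioms ⊆ {propext, Classical.choice,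
Quot.sound}.
-/

namespace Summit.Ventures.HodgeRepro2.T5SU11ResolventTransformClass

open Filter Topology MeasureTheory
open Set (Ioi Ioc Icc)
open T5SU11Cartan T5SU11SphericalFunction T5SU11SphericalBounds T5SU11SphericalContinuous
  T5SU11SphericalSolutionSpaceAll T5SU11SphericalDecay T5SU11RadialGreenKernel T5SU11RadialGreenPositivity
  T5SU11RadialGreenImproper T5SU11RadialGreenImproperDecaySource T5SU11ResolventCommute
  T5SU11ResolventKernelComposition T5SU11ResolventWeightedBasis T5SU11KernelResolventIdentity
  T5SU11KernelDifferenceRegularity T5SU11ResolventEigenfunction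

/-! ### Integrability of the kernel integrand -/

/-- For a source integrable against the basis, `s ↦ K(t, s) g(s) sinh 2s` is integrable on `(0, ∞)`. -/
theorem integrableOn_kernel_mul {φ χ g : ℝ → ℝ}
    (hB : ∀ T, IntegrableOn (fun s => φ s * g s * Real.sinh (2 * s)) (Ioc 0 T))
    (hA : IntegrableOn (fun s => χ s * g s * Real.sinh (2 * s)) (Ioi 0)) {t : ℝ} (ht : 0 < t) :
    IntegrableOn (fun s => greenKernel φ χ t s * g s * Real.sinh (2 * s)) (Ioi 0) := by
  have hsplit : Ioc 0 t ∪ Ioi t = Ioi 0 := Set.Ioc_union_Ioi_eq_Ioi ht.le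
  have h1 : Set.EqOn (fun s => greenKernel φ χ t s * g s * Real.sinh (2 * s))
      (fun s => -χ t * (φ s * g s * Real.sinh (2 * s))) (Ioc 0 t) := by
    intro s hs
    simp only
    rw [greenKernel_of_le φ χ hs.2]
    ring
  have h2 : Set.EqOn (fun s => greenKernel φ χ t s * g s * Real.sinh (2 * s))
      (fun s => -φ t * (χ s * g s * Real.sinh (2 * s))) (Ioi t) := by
    intro s hs
    simp only
    rw [greenKernel_of_ge φ χ (le_of_lt hs)]
    ring
  have hI1 : IntegrableOn (fun s => greenKernel φ χ t s * g s * Real.sinh (2 * s)) (Ioc 0 t) :=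
    IntegrableOn.congr_fun ((hB t).const_mul (-χ t)) h1.symm measurableSet_Ioc
  have hI2 : IntegrableOn (fun s => greenKernel φ χ t s * g s * Real.sinh (2 * s)) (Ioi t) :=
    IntegrableOn.congr_fun ((hA.mono_set (Set.Ioi_subset_Ioi ht.le)).const_mul (-φ t)) h2.symm measurableSet_Ioi
  rw [← hsplit]
  exact hI1.union hI2

section measure

variable [MeasurableSpace Circle] [BorelSpace Circle]

variable {lam lam' : ℝ} (hlam : 1 < lam) (h1 : 1 < lam') (h2 : lam' < lam)
  {g : ℝ → ℝ} (hg : ContinuousOn g (Ioi 0))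
  {M : ℝ} (hM : ∀ s ∈ Ioc (0 : ℝ) 1, |g s| ≤ M) (hM0 : 0 ≤ M)
  {ε C s₀ : ℝ} (hε : lam' < ε) (hC : ∀ s, s₀ ≤ s → |g s| ≤ C * Real.exp (-ε * s))

include h1 hg hM hM0 hε hC in
/-- **`φ_{λ′} g sinh 2s` is integrable on `(0, ∞)`** for a source of the class at a rate `ε > λ′`. -/
theorem integrableOn_sph_mul_mul_sinh_Ioi :
    IntegrableOn (fun s => sph lam' (hyp s) * g s * Real.sinh (2 * s)) (Ioi 0) := by
  obtain ⟨c₁, hc₁, hφ⟩ := exists_sph_hyp_le_exp h1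
  have hC0 : 0 ≤ C := by
    have h := hC (max s₀ 0) (le_max_left _ _)
    have := abs_nonneg (g (max s₀ 0))
    have := Real.exp_pos (-ε * max s₀ 0)
    nlinarith
  set T := max s₀ 1 with hT
  have hT1 : 1 ≤ T := le_max_right _ _
  have hsplit : Ioc 0 T ∪ Ioi T = Ioi 0 := Set.Ioc_union_Ioi_eq_Ioi (by linarith)
  have hI1 : IntegrableOn (fun s => sph lam' (hyp s) * g s * Real.sinh (2 * s)) (Ioc 0 T) :=
    integrableOn_sph_mul_mul_sinh_Ioc hg hM hM0 lam' T
  have hI2 : IntegrableOn (fun s => sph lam' (hyp s) * g s * Real.sinh (2 * s)) (Ioi T) := by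
    have hcont : ContinuousOn (fun s => sph lam' (hyp s) * g s * Real.sinh (2 * s)) (Ioi T) :=
      (((continuous_sph_hyp lam').continuousOn.mul hg).mul
        (Real.continuous_sinh.comp (continuous_const.mul continuous_id)).continuousOn).mono
        (Set.Ioi_subset_Ioi (by linarith))
    have hdom : IntegrableOn (fun s => c₁ * C / 2 * Real.exp (-(ε - lam') * s)) (Ioi T) :=
      (exp_neg_integrableOn_Ioi T (by linarith)).const_mul _
    refine Integrable.mono' hdom (hcont.aestronglyMeasurable measurableSet_Ioi) ?_
    refine (ae_restrict_iff' measurableSet_Ioi).mpr (Eventually.of_forall fun s hs => ?_)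
    have hs0 : 0 < s := lt_of_le_of_lt (by linarith : (0 : ℝ) ≤ T) hs
    have hsinh : 0 ≤ Real.sinh (2 * s) := Real.sinh_nonneg_iff.mpr (by linarith)
    rw [Real.norm_eq_abs, abs_mul, abs_mul, abs_of_pos (sph_hyp_pos lam' s), abs_of_nonneg hsinh]
    have hE : Real.exp (-(ε - lam') * s) = Real.exp ((lam' - 2) * s) * Real.exp (-ε * s) * Real.exp (2 * s) := by
      rw [← Real.exp_add, ← Real.exp_add]; congr 1; ring
    rw [hE]
    have e1 := hφ s hs0.le
    have e2 := hC s (le_trans (le_max_left _ _) (le_of_lt hs))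
    have e3 := sinh_le_exp_div_two (2 * s)
    calc sph lam' (hyp s) * |g s| * Real.sinh (2 * s)
        ≤ (c₁ * Real.exp ((lam' - 2) * s)) * (C * Real.exp (-ε * s)) * (Real.exp (2 * s) / 2) :=
          mul_le_mul (mul_le_mul e1 e2 (abs_nonneg _) (by positivity)) e3 hsinh (by positivity)
      _ = c₁ * C / 2 * (Real.exp ((lam' - 2) * s) * Real.exp (-ε * s) * Real.exp (2 * s)) := by ring
  rw [← hsplit]
  exact hI1.union hI2

include hlam h1 h2 in
/-- `t ↦ K_λ(t, s) φ_{λ′}(t) sinh 2t` is integrable on `(0, ∞)` for every `s > 0`. -/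
theorem integrableOn_kernel_mul_sph {s : ℝ} (hs : 0 < s) :
    IntegrableOn (fun t => sphGreenKernel lam t s * sph lam' (hyp t) * Real.sinh (2 * t)) (Ioi 0) := by
  obtain ⟨Φ, hΦ0, hΦ⟩ := exists_abs_sph_le_one lam'
  obtain ⟨C', s₀', hC'⟩ := exists_abs_sph_le_exp h1
  have hg' : ContinuousOn (fun t => sph lam' (hyp t)) (Ioi 0) := (continuous_sph_hyp lam').continuousOn
  have hB := integrableOn_sph_mul_mul_sinh_Ioc hg' hΦ hΦ0 lam
  have hA := integrableOn_sphDecay_mul_mul_sinh hlam hg' hΦ hΦ0 (by linarith : 2 - lam < 2 - lam') hC'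
  have h := integrableOn_kernel_mul hB hA hs
  refine h.congr_fun ?_ measurableSet_Ioi
  intro t _
  simp only [sphGreenKernel]
  rw [greenKernel_symm]

include hlam h1 h2 in
/-- **The eigenfunction identity in the first variable**: `∫_{(0,∞)} K_λ(t, s) φ_{λ′}(t) sinh 2t dt = φ_{λ′}(s)/(μ′ − μ)`. -/
theorem integral_kernel_mul_sph_fst {s : ℝ} (hs : 0 < s) :
    ∫ t in Ioi 0, sphGreenKernel lam t s * sph lam' (hyp t) * Real.sinh (2 * t)
      = sph lam' (hyp s) / (lam' * (lam' - 2) - lam * (lam - 2)) := by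
  rw [← integral_kernel_mul_sph hlam h1 h2 hs]
  apply MeasureTheory.integral_congr_ae
  refine Eventually.of_forall fun t => ?_
  simp only
  rw [sphGreenKernel_symm]

include hlam h1 h2 in
/-- The absolute version: `∫_{(0,∞)} |K_λ(t, s)| φ_{λ′}(t) sinh 2t dt = φ_{λ′}(s)/(μ − μ′)` (the kernel is negative). -/
theorem integral_abs_kernel_mul_sph_fst {s : ℝ} (hs : 0 < s) :
    ∫ t in Ioi 0, |sphGreenKernel lam t s * sph lam' (hyp t) * Real.sinh (2 * t)|
      = sph lam' (hyp s) / (lam * (lam - 2) - lam' * (lam' - 2)) := by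
  have h := integral_kernel_mul_sph_fst hlam h1 h2 hs
  have e : ∫ t in Ioi 0, |sphGreenKernel lam t s * sph lam' (hyp t) * Real.sinh (2 * t)|
      = -∫ t in Ioi 0, sphGreenKernel lam t s * sph lam' (hyp t) * Real.sinh (2 * t) := by
    rw [← MeasureTheory.integral_neg]
    apply setIntegral_congr_fun measurableSet_Ioi
    intro t ht
    have ht0 : 0 < t := ht
    have hK : sphGreenKernel lam t s ≤ 0 := (sphGreenKernel_neg hlam ht0).le
    have hφ : 0 < sph lam' (hyp t) := sph_hyp_pos lam' t
    have hsinh : 0 ≤ Real.sinh (2 * t) := Real.sinh_nonneg_iff.mpr (by linarith)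
    simp only
    rw [abs_of_nonpos (mul_nonpos_of_nonpos_of_nonneg (mul_nonpos_of_nonpos_of_nonneg hK hφ.le) hsinh)]
  rw [e, h, ← div_neg, neg_sub]

/-! ### Fubini -/

include hlam h1 h2 hg hM hM0 hε hC in
/-- **The product integrand `K_λ(t, s) g(s) sinh 2s · φ_{λ′}(t) sinh 2t` is integrable on `(0, ∞) × (0, ∞)`.** -/
theorem integrable_prod_kernel :
    Integrable (Function.uncurry fun t s => sphGreenKernel lam t s * g s * Real.sinh (2 * s)
        * (sph lam' (hyp t) * Real.sinh (2 * t)))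
      ((volume.restrict (Ioi 0)).prod (volume.restrict (Ioi 0))) := by
  have hχ : ContinuousOn (sphDecay lam) (Ioi 0) :=
    fun _ hr => (hasDerivAt_sphDecay hlam hr).continuousAt.continuousWithinAt
  -- measurability: the integrand is continuous on the open quadrant
  have hmeas : AEStronglyMeasurable (Function.uncurry fun t s => sphGreenKernel lam t s * g s * Real.sinh (2 * s)
      * (sph lam' (hyp t) * Real.sinh (2 * t))) ((volume.restrict (Ioi 0)).prod (volume.restrict (Ioi 0))) := by
    rw [Measure.prod_restrict]
    refine ContinuousOn.aestronglyMeasurable ?_ (measurableSet_Ioi.prod measurableSet_Ioi)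
    have hK : ContinuousOn (fun p : ℝ × ℝ => sphGreenKernel lam p.1 p.2) (Ioi 0 ×ˢ Ioi 0) := by
      simp only [sphGreenKernel, greenKernel]
      apply ContinuousOn.neg
      apply ContinuousOn.mul
      · exact ((continuous_sph_hyp lam).comp (continuous_fst.min continuous_snd)).continuousOn
      · exact hχ.comp (continuous_fst.max continuous_snd).continuousOn
          (fun p hp => Set.mem_Ioi.mpr (lt_of_lt_of_le (Set.mem_Ioi.mp hp.1) (le_max_left _ _)))
    have hg' : ContinuousOn (fun p : ℝ × ℝ => g p.2) (Ioi 0 ×ˢ Ioi 0) :=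
      hg.comp continuous_snd.continuousOn (fun p hp => hp.2)
    exact ((hK.mul hg').mul
      (Real.continuous_sinh.comp (continuous_const.mul continuous_snd)).continuousOn).mul
      (((continuous_sph_hyp lam').comp continuous_fst).mul
        (Real.continuous_sinh.comp (continuous_const.mul continuous_fst))).continuousOn
  rw [integrable_prod_iff' hmeas]
  refine ⟨?_, ?_⟩
  · -- for every `s > 0`, `t ↦ F t s` is integrable
    refine (ae_restrict_iff' measurableSet_Ioi).mpr (Eventually.of_forall fun s hs => ?_)
    have hs0 : 0 < s := hs
    have h := (integrableOn_kernel_mul_sph hlam h1 h2 hs0).mul_const (g s * Real.sinh (2 * s))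
    refine h.congr (Eventually.of_forall fun t => ?_)
    simp only [Function.uncurry_apply_pair]
    ring
  · -- the outer integrand `∫_t ‖F t s‖ = |g s| sinh 2s · φ_{λ′}(s)/(μ − μ′)`
    have hI := ((integrableOn_sph_mul_mul_sinh_Ioi h1 hg hM hM0 hε hC).abs).mul_const
      (1 / (lam * (lam - 2) - lam' * (lam' - 2)))
    refine hI.congr ?_
    refine (ae_restrict_iff' measurableSet_Ioi).mpr (Eventually.of_forall fun s hs => ?_)
    have hs0 : 0 < s := hs
    have hsinh : 0 ≤ Real.sinh (2 * s) := Real.sinh_nonneg_iff.mpr (by linarith)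
    have e : ∀ t, ‖Function.uncurry (fun t s => sphGreenKernel lam t s * g s * Real.sinh (2 * s)
        * (sph lam' (hyp t) * Real.sinh (2 * t))) (t, s)‖
        = |sphGreenKernel lam t s * sph lam' (hyp t) * Real.sinh (2 * t)| * (|g s| * Real.sinh (2 * s)) := by
      intro t
      simp only [Function.uncurry_apply_pair, Real.norm_eq_abs]
      rw [show sphGreenKernel lam t s * g s * Real.sinh (2 * s) * (sph lam' (hyp t) * Real.sinh (2 * t))
        = (sphGreenKernel lam t s * sph lam' (hyp t) * Real.sinh (2 * t)) * (g s * Real.sinh (2 * s)) by ring,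
        abs_mul, abs_mul (g s), abs_of_nonneg hsinh]
    simp only [e]
    rw [MeasureTheory.integral_mul_const, integral_abs_kernel_mul_sph_fst hlam h1 h2 hs0, abs_mul, abs_mul,
      abs_of_pos (sph_hyp_pos lam' s), abs_of_nonneg hsinh]
    ring

include hlam h1 h2 hg hM hM0 hε hC in
/-- **THE SPHERICAL TRANSFORM DIAGONALISES THE RESOLVENT ON THE CLASS**: for `1 < λ′ < λ` and a source of the class
at a rate `ε > λ′`, `∫_{(0,∞)} G^I_λ g · φ_{λ′} sinh 2t dt = (∫_{(0,∞)} g φ_{λ′} sinh 2s ds)/(μ′ − μ)`. -/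
theorem transform_greenSolI_eq :
    ∫ t in Ioi 0, greenSolI (fun t => sph lam (hyp t)) (sphDecay lam) g t * sph lam' (hyp t) * Real.sinh (2 * t)
      = (∫ s in Ioi 0, g s * sph lam' (hyp s) * Real.sinh (2 * s)) / (lam' * (lam' - 2) - lam * (lam - 2)) := by
  have hF := integrable_prod_kernel hlam h1 h2 hg hM hM0 hε hC
  have hswap := integral_integral_swap hF
  -- class data of `g` for the kernel representation of `G^I_λ g`
  have hB := integrableOn_sph_mul_mul_sinh_Ioc hg hM hM0 lam
  have hA := integrableOn_sphDecay_mul_mul_sinh hlam hg hM hM0 (by linarith : 2 - lam < ε) hC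
  -- the left-hand side of Fubini is the transform of the resolvent
  have hL : ∫ t in Ioi 0, ∫ s in Ioi 0, sphGreenKernel lam t s * g s * Real.sinh (2 * s)
      * (sph lam' (hyp t) * Real.sinh (2 * t))
      = ∫ t in Ioi 0, greenSolI (fun t => sph lam (hyp t)) (sphDecay lam) g t * sph lam' (hyp t)
        * Real.sinh (2 * t) := by
    apply setIntegral_congr_fun measurableSet_Ioi
    intro t ht
    have ht0 : 0 < t := ht
    simp only
    rw [MeasureTheory.integral_mul_const, greenSolI_eq_integral_kernel hB hA ht0]
    simp only [sphGreenKernel]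
    ring
  -- the right-hand side is the transform of the source, divided by `μ′ − μ`
  have hR : ∫ s in Ioi 0, ∫ t in Ioi 0, sphGreenKernel lam t s * g s * Real.sinh (2 * s)
      * (sph lam' (hyp t) * Real.sinh (2 * t))
      = ∫ s in Ioi 0, g s * sph lam' (hyp s) * Real.sinh (2 * s) / (lam' * (lam' - 2) - lam * (lam - 2)) := by
    apply setIntegral_congr_fun measurableSet_Ioi
    intro s hs
    have hs0 : 0 < s := hs
    simp only
    have e : ∀ t, sphGreenKernel lam t s * g s * Real.sinh (2 * s) * (sph lam' (hyp t) * Real.sinh (2 * t))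
        = sphGreenKernel lam t s * sph lam' (hyp t) * Real.sinh (2 * t) * (g s * Real.sinh (2 * s)) := by
      intro t; ring
    simp only [e]
    rw [MeasureTheory.integral_mul_const, integral_kernel_mul_sph_fst hlam h1 h2 hs0]
    ring
  rw [← hL, hswap, hR, MeasureTheory.integral_div]

end measure

end Summit.Ventures.HodgeRepro2.T5SU11ResolventTransformClass
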